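import Mathlib.LinearAlgebra.FiniteDimensional.Lemmas
import Mathlib.LinearAlgebra.Dimension.StrongRankCondition
import Mathlib.Algebra.Exact.Basic
import Mathlib.Tactic.Linarith
import Mathlib.Tactic.Ring
import HarnessLib

/-!
# The (0,1) cell of the ι-window, EXCLUSION side, IX: the TANGENT form of the Quot-dimension sieve and the homological tangent bound

Family `hodge`, b2b cell `hweil` (helper of item stmt-HodgeConjecture-2524). Report
`run/shared/lean/b2b/hodge-weil/b2b-hweil-pv1-g21/H2-ZERO-ONE-9.md` (prover 1 gen 21). Companion to `WeilTypeLadderH2QuotSieveAllN.lean`,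
`WeilTypeLadderH2ClassZLoewyThree.lean`, `WeilTypeLadderH2ClassZM0CaseB.lean` (same dictionary: `A = k[[x₁,…,x₄]]` with all coordinates ι-odd,
`M = F′_x` the canonical hull at an ι-fixed point (rank 2, `pd_A M ≤ 2`, minimal ι-equivariant free resolution `0 → P₂ → P₁ → P₀ → M` with
`β₂ ∈ {0,1,2}`), `F ⊂ M` ι-stable of finite colength, `T₀ = M/F = V₊ ⊕ V₋` BALANCED of sign-lengths `(n,n)`,
`tan := dim_k Hom_A(F,T₀)^ι` = Zariski tangent space of `Quot^ι_x(M; n,n)` at `[F]`).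
HONEST FRAMING: a structure result about one cell of the ladder's H2 test on the exclusion side; no case of the Hodge conjecture is proved;
nothing here is a rung; no statement of [Markman 2025] is used.

THE TWO RESULTS whose linear-algebra / integer skeletons are checked here (the sheaf and module theory is in the report and the docstrings):

(QT) TANGENT FORM OF (QD) [report §1]. For a (0,1) candidate `F` of shape (a) with flat hull `E`, canonical module `F′ = ker(E ↠ G)` and
fixed-point torsion `T₀ = F′/F`, the long exact sequence of `Hom_X(F,−)^ι` applied to `0 → F → F′ → T₀ → 0` reads
`0 → Hom(F,F)^ι → Hom(F,F′)^ι → Hom(F,T₀)^ι → Ext¹(F,F)^ι`, and `Hom(F,F)^ι = k = Hom(F,F′)^ι` (simplicity; the Aut-line of (TM):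
`Hom(F,F′) ⊂ Hom(F,E) = End(E)` and a non-scalar ι-invariant endomorphism of `E` never maps `F` into `F′`). Hence the connecting map is
INJECTIVE and `e₁^ι(F) = dim Ext¹(F,F)^ι ≥ dim Hom_X(F,T₀)^ι = Σ_x tan_x` — the Zariski TANGENT dimension of the ι-Quot scheme bounds `e₁^ι`
from below, with no family, no integrability and no reducedness needed (the earlier (QD) used the local DIMENSION `d_x ≤ tan_x`).
Skeleton: `qt_finrank_le_of_exact` (a five-term exact sequence of finite-dimensional spaces `V₀ → V₁ → V₂ → V₃ → V₄`, exact at `V₁,V₂,V₃`,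
has `dim V₁ + dim V₃ ≤ dim V₀ + dim V₂ + dim V₄`; PROVED here over any division ring) and its instance `qt_e1_ge_tan`.

(T²) THE HOMOLOGICAL TANGENT BOUND [report §2]. From `Hom_A(−,T₀)^ι` applied to `0 → F → M → T₀ → 0`:
`tan ≥ hom^ι(M,T₀) − end^ι(T₀) + ext¹(T₀,T₀)^ι − ext¹(M,T₀)^ι` (`qt_finrank_le_of_exact` again). Three exact counts turn this into a bound free
of `hom` and `end`: (i) `hom^ι(M,T₀) − ext¹^ι(M,T₀) + ext²^ι(M,T₀) = 2n` (Euler characteristic of `Hom^ι(P•,T₀)`: each free generator of any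
sign contributes `n` because `T₀` is balanced, and `β₀ − β₁ + β₂ = rank M = 2`); (ii) `χ^ι(T₀,T₀) = Σ(−1)^i ext^i(T₀,T₀)^ι = 8(n₊ − n₋)² = 0`
(bi-additivity; `χ^ι(k_a,k_b) = ±8` from `Ext^i(k,k) = Λ^i(𝔪/𝔪²)^∨` on which ι acts by `(−1)^i`); (iii) local duality
`Ext^i_A(N₁,N₂)^∨ ≅ Ext^{4−i}_A(N₂,N₁)` for finite-length ι-modules (ι acts trivially on `Ext⁴(k,A) = det(𝔪/𝔪²)^{-1}` since `(−1)⁴ = 1`), so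
`e³ = e¹`, `e⁴ = e⁰` and therefore `e¹ = e⁰ + e²/2`. RESULT: `tan ≥ 2n − ext²^ι(M,T₀) + ext²^ι(T₀,T₀)/2 ≥ 2n − β₂·n`, i.e.
`tan ≥ 2n` on `M⁰` and the non-Cartier type NB (`β₂ = 0`), `tan ≥ n` on `M_𝔞` and the types '±' (`β₂ = 1`). With (QT): every (0,1) candidate
with fixed-point torsion of sign-lengths `(n,n)`, `n ≥ 2`, at a point with one of these hulls has `e₁^ι ≥ 2` — for every `n`, every base ideal,
every Loewy length, with no class-Z analysis (machine corroboration `code/pv1-g21/qt_check.py`: the identities (i)–(iii) and the bound hold at every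
sampled point, all hull types).

(T³) `e² ≥ 6` AND `tan ≥ 3` UNIVERSALLY [report §2.6–2.7]. `A`-modules of finite length are modules over the (completed) cocommutative Hopf algebra
`U(𝔞)`, `𝔞 = k⁴` abelian (the `x_i` primitive), so `Ext^i_A(T₀,T₀) = H^i(𝔞; End_k T₀)` (Chevalley–Eilenberg, `𝔞` acting by `ad X_i`; ι-invariants =
the even part). The scalars `k·id ⊂ End_k T₀` form a trivial 𝔞-submodule, split off by `tr/2n` (char 0; `tr∘ad = 0`), so `H^•(𝔞;k)_ev = Λ^{ev}(k⁴)` is a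
direct summand: `e⁰ ≥ 1`, `e² ≥ dim Λ² = 6`, `e⁴ ≥ 1`. Hence `tan ≥ 2n − ext²^ι(M,T₀) + 3 ≥ (2 − β₂)n + 3 ≥ 3` for EVERY hull type (including 'd',
`β₂ = 2`) and every `n ≥ 1`; with (QT), fixed-point torsion `T₀ ≠ 0` forces `e₁^ι ≥ 3`: NO (0,1) candidate of shape (a) with flat hull has
fixed-point torsion. Machine: `qt_check.py` (all hulls, all samplers: the bound holds with slack `ρ′ ≥ 0`, once with equality), `e1_crosscheck.py`
(the CE value of `e¹` agrees with the syzygy computation `hom^ι(K,T₀) − n·μ₀ + e⁰` on 60/60 modules), `e2_probe.py` (`e² ≥ 12` observed).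
-/

-- mandated namespace `Summit.HodgeConjecture.HodgeConjecture.…` (Problem = Summit) trips `linter.dupNamespace`; the lakefile disables it
-- tree-wide (weak option), restated here so stand-alone elaboration is warning-free too.
set_option linter.dupNamespace false

namespace Summit.HodgeConjecture.HodgeConjecture.WeilTypeLadder

section H2QuotTangent

open Module

/-- DIMENSION COUNT ALONG A FIVE-TERM EXACT SEQUENCE (proved, any division ring). If `V₀ → V₁ → V₂ → V₃ → V₄` are linear maps of
finite-dimensional spaces, exact at `V₁`, `V₂` and `V₃`, then `dim V₁ + dim V₃ ≤ dim V₀ + dim V₂ + dim V₄`. (Rank–nullity three times: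
`dim V₁ = rk f₁ + rk f₀ ≤ rk f₁ + dim V₀`, `dim V₂ = rk f₂ + rk f₁`, `dim V₃ = rk f₃ + rk f₂ ≤ dim V₄ + rk f₂`.) This is the skeleton of both
(QT) and (T²). [H2-ZERO-ONE-9 §1–§2] -/
theorem qt_finrank_le_of_exact {K : Type*} [DivisionRing K]
    {V₀ V₁ V₂ V₃ V₄ : Type*} [AddCommGroup V₀] [Module K V₀] [AddCommGroup V₁] [Module K V₁] [AddCommGroup V₂] [Module K V₂]
    [AddCommGroup V₃] [Module K V₃] [AddCommGroup V₄] [Module K V₄]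
    [FiniteDimensional K V₀] [FiniteDimensional K V₁] [FiniteDimensional K V₂] [FiniteDimensional K V₃] [FiniteDimensional K V₄]
    (f₀ : V₀ →ₗ[K] V₁) (f₁ : V₁ →ₗ[K] V₂) (f₂ : V₂ →ₗ[K] V₃) (f₃ : V₃ →ₗ[K] V₄)
    (h₁ : Function.Exact f₀ f₁) (h₂ : Function.Exact f₁ f₂) (h₃ : Function.Exact f₂ f₃) :
    finrank K V₁ + finrank K V₃ ≤ finrank K V₀ + finrank K V₂ + finrank K V₄ := by
  have e₁ := LinearMap.finrank_range_add_finrank_ker f₁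
  have e₂ := LinearMap.finrank_range_add_finrank_ker f₂
  have e₃ := LinearMap.finrank_range_add_finrank_ker f₃
  rw [LinearMap.exact_iff.mp h₁] at e₁
  rw [LinearMap.exact_iff.mp h₂] at e₂
  rw [LinearMap.exact_iff.mp h₃] at e₃
  have r₀ : finrank K (LinearMap.range f₀) ≤ finrank K V₀ := LinearMap.finrank_range_le f₀
  have r₃ : finrank K (LinearMap.range f₃) ≤ finrank K V₄ := Submodule.finrank_le _
  omega

/-- (QT), THE TANGENT FORM OF THE QUOT-DIMENSION SIEVE — linear-algebra instance. The exact sequence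
`0 → Hom(F,F)^ι → Hom(F,F′)^ι → Hom(F,T₀)^ι → Ext¹(F,F)^ι` (`V₀ = 0`), with `dim Hom(F,F)^ι = dim Hom(F,F′)^ι` (both `= 1`: `F` simple and the
Aut-line of (TM)), gives `e₁^ι = dim Ext¹(F,F)^ι ≥ dim Hom(F,T₀)^ι = tan`. [H2-ZERO-ONE-9 §1, LEMMA (QT)] -/
theorem qt_e1_ge_tan {K : Type*} [DivisionRing K]
    {H₀ H₁ H₂ E₁ : Type*} [AddCommGroup H₀] [Module K H₀] [AddCommGroup H₁] [Module K H₁] [AddCommGroup H₂] [Module K H₂]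
    [AddCommGroup E₁] [Module K E₁] [FiniteDimensional K H₀] [FiniteDimensional K H₁] [FiniteDimensional K H₂] [FiniteDimensional K E₁]
    (i : H₀ →ₗ[K] H₁) (r : H₁ →ₗ[K] H₂) (δ : H₂ →ₗ[K] E₁)
    (hi : Function.Injective i) (h₁ : Function.Exact i r) (h₂ : Function.Exact r δ)
    (hdim : finrank K H₀ = finrank K H₁) :
    finrank K H₂ ≤ finrank K E₁ := by
  have e₁ := LinearMap.finrank_range_add_finrank_ker r
  have e₂ := LinearMap.finrank_range_add_finrank_ker δ
  rw [LinearMap.exact_iff.mp h₁] at e₁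
  rw [LinearMap.exact_iff.mp h₂] at e₂
  have ri : finrank K (LinearMap.range i) = finrank K H₀ := LinearMap.finrank_range_of_inj hi
  have rδ : finrank K (LinearMap.range δ) ≤ finrank K E₁ := Submodule.finrank_le _
  omega

/-- (T²) THE LONG-EXACT-SEQUENCE STEP — linear-algebra instance. `Hom_A(−,T₀)^ι` on `0 → F → M → T₀ → 0` gives the exact
`End^ι(T₀) → Hom^ι(M,T₀) → Hom^ι(F,T₀) → Ext¹(T₀,T₀)^ι → Ext¹(M,T₀)^ι`, hence
`hom^ι(M,T₀) + ext¹^ι(T₀,T₀) ≤ end^ι(T₀) + tan + ext¹^ι(M,T₀)`. [H2-ZERO-ONE-9 §2, PROPOSITION 2.1 (iii)] -/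
theorem qt_les_step {K : Type*} [DivisionRing K]
    {W₀ W₁ W₂ W₃ W₄ : Type*} [AddCommGroup W₀] [Module K W₀] [AddCommGroup W₁] [Module K W₁] [AddCommGroup W₂] [Module K W₂]
    [AddCommGroup W₃] [Module K W₃] [AddCommGroup W₄] [Module K W₄]
    [FiniteDimensional K W₀] [FiniteDimensional K W₁] [FiniteDimensional K W₂] [FiniteDimensional K W₃] [FiniteDimensional K W₄]
    (π₀ : W₀ →ₗ[K] W₁) (res : W₁ →ₗ[K] W₂) (δ : W₂ →ₗ[K] W₃) (π₁ : W₃ →ₗ[K] W₄)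
    (h₁ : Function.Exact π₀ res) (h₂ : Function.Exact res δ) (h₃ : Function.Exact δ π₁) :
    finrank K W₁ + finrank K W₃ ≤ finrank K W₀ + finrank K W₂ + finrank K W₄ :=
  qt_finrank_le_of_exact π₀ res δ π₁ h₁ h₂ h₃

/-- χ^ι(T₀,T₀) FOR A FINITE-LENGTH ι-MODULE OF SIGN-LENGTHS `(n₊,n₋)`: with `χ^ι(k_a,k_a) = 1 + 6 + 1 = 8` and `χ^ι(k_a,k_{−a}) = −(4 + 4) = −8`
(`Ext^i(k,k) = Λ^i k⁴`, ι acts by `(−1)^i·ab`), bi-additivity gives `χ^ι(T₀,T₀) = 8n₊² + 8n₋² − 16n₊n₋ = 8(n₊ − n₋)²`, which vanishes iff `T₀` is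
BALANCED. [H2-ZERO-ONE-9 §2, LEMMA 2.2 (ii)] -/
theorem qt_chi_T0 (np nm : ℤ) :
    8 * np ^ 2 + 8 * nm ^ 2 - 16 * np * nm = 8 * (np - nm) ^ 2 ∧ (8 * (np - nm) ^ 2 = 0 ↔ np = nm) := by
  refine ⟨by ring, ?_⟩
  constructor
  · intro h
    have : (np - nm) ^ 2 = 0 := by linarith
    have := pow_eq_zero_iff (n := 2) (by norm_num) |>.mp this
    linarith
  · intro h
    subst h
    ring

/-- The Koszul signs behind `qt_chi_T0`: `Σ_{i even} C(4,i) = 8 = Σ_{i odd} C(4,i)`. -/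
theorem qt_koszul_even_odd : (1 + 6 + 1 : ℤ) = 8 ∧ (4 + 4 : ℤ) = 8 := by norm_num

/-- LOCAL DUALITY + INDEX ⟹ `e¹ = e⁰ + e²/2`. For a balanced finite-length ι-module `T₀` put `eⁱ = ext^i_A(T₀,T₀)^ι`; local duality on the
regular 4-dimensional `A` gives `e³ = e¹`, `e⁴ = e⁰` (ι acts on `Ext⁴(k,A)` by `(−1)⁴ = +1`), and `χ^ι = 0` (`qt_chi_T0`); hence `e²` is even and
`2e¹ = 2e⁰ + e²`, in particular `e¹ ≥ e⁰`. [H2-ZERO-ONE-9 §2, LEMMA 2.2 (iii)] -/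
theorem qt_e1_formula (e0 e1 e2 e3 e4 : ℤ) (hd3 : e3 = e1) (hd4 : e4 = e0) (hchi : e0 - e1 + e2 - e3 + e4 = 0) (he2 : 0 ≤ e2) :
    2 * e1 = 2 * e0 + e2 ∧ e0 ≤ e1 := by
  subst hd3; subst hd4
  constructor <;> linarith

/-- EULER CHARACTERISTIC OF `Hom^ι(P•,T₀)` FOR THE HULL. `M` has rank 2 and `pd_A M ≤ 2` with Betti numbers `(β₀,β₁,β₂)` (`(5,4,1)` for `M_𝔞`,
`(3,1,0)` for `M⁰`, `(4,2,0)`, `(5,4,1)`, `(5,4,1)`, `(6,6,2)` for NB, '+', '−', 'd'), so `β₀ − β₁ + β₂ = 2`; a free generator of either sign contributes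
exactly `n` to `hom^ι(P_j,T₀)` because `T₀` is balanced; hence `hom^ι(M,T₀) − ext¹^ι(M,T₀) + ext²^ι(M,T₀) = n(β₀ − β₁ + β₂) = 2n`.
[H2-ZERO-ONE-9 §2, LEMMA 2.2 (i)] -/
theorem qt_chi_M (n β₀ β₁ β₂ h0 h1 h2 : ℤ) (hrank : β₀ - β₁ + β₂ = 2) (hchi : h0 - h1 + h2 = n * β₀ - n * β₁ + n * β₂) :
    h0 - h1 + h2 = 2 * n := by
  have : n * β₀ - n * β₁ + n * β₂ = n * (β₀ - β₁ + β₂) := by ring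
  rw [hchi, this, hrank]; ring

/-- The six hull types' Betti numbers satisfy `β₀ − β₁ + β₂ = 2` (rank two): `M_𝔞 (5,4,1)`, `M⁰ (3,1,0)`, NB `(4,2,0)`, '+'/'−' `(5,4,1)`, 'd' `(6,6,2)`
(H2-ZERO-ONE-4 §1 / 14.4; the second Betti numbers are re-derived by machine in `qt_check.py describe`). -/
theorem qt_betti_hulls :
    (5 - 4 + 1 : ℤ) = 2 ∧ (3 - 1 + 0 : ℤ) = 2 ∧ (4 - 2 + 0 : ℤ) = 2 ∧ (6 - 6 + 2 : ℤ) = 2 := by norm_num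

/-- (T²) THE HOMOLOGICAL TANGENT BOUND — integer skeleton. Inputs: the LES step `h0M + e1 ≤ e0 + tan + h1M` (`qt_les_step`), the resolution count
`h0M − h1M + h2M = 2n` (`qt_chi_M`), duality+index `2e1 = 2e0 + e2` (`qt_e1_formula`). Output: `2·tan ≥ 4n − 2·ext²^ι(M,T₀) + ext²^ι(T₀,T₀)`;
`hom^ι(M,T₀)` and `end^ι(T₀)` CANCEL. [H2-ZERO-ONE-9 §2, THEOREM T²] -/
theorem qt_master (n tan h0M h1M h2M e0 e1 e2 : ℤ)
    (hles : h0M + e1 ≤ e0 + tan + h1M) (hchiM : h0M - h1M + h2M = 2 * n) (hdual : 2 * e1 = 2 * e0 + e2) :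
    4 * n - 2 * h2M + e2 ≤ 2 * tan := by
  linarith

/-- (T²) for the hulls with `β₂ ≤ 1` (`M_𝔞`, `M⁰`, NB, '+', '−'): `ext²^ι(M,T₀) ≤ β₂·n ≤ n` and `e2 ≥ 0` give `tan ≥ n`; for `β₂ = 0` (`M⁰`, NB)
`tan ≥ 2n`. With (QT) (`e₁^ι ≥ tan`): fixed-point torsion of sign-lengths `(n,n)` with `n ≥ 2` at such a point forces `e₁^ι ≥ 2` — the candidate
is NOT a (0,1) object, for every `n ≥ 2`, every base ideal and every Loewy length. [H2-ZERO-ONE-9 §2 COROLLARY 2.4, §3] -/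
theorem qt_tan_ge_n (n tan h2M e1 e2 : ℤ) (hmaster : 4 * n - 2 * h2M + e2 ≤ 2 * tan) (h2 : h2M ≤ n) (he2 : 0 ≤ e2)
    (hQT : tan ≤ e1) :
    n ≤ tan ∧ (h2M = 0 → 2 * n ≤ tan) ∧ (2 ≤ n → 2 ≤ e1) := by
  refine ⟨by linarith, fun h0 => by subst h0; linarith, fun hn => by linarith⟩

/-- THE `n = 1` CORNER AND SEVERAL TORSION POINTS. `e₁^ι ≥ Σ_x tan_x` (QT). If some torsion point has `n_x ≥ 2` then `e₁^ι ≥ 2` (`qt_tan_ge_n`);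
if two fixed points carry torsion then `e₁^ι ≥ 1 + 1`; and a single point with `n_x = 1` has `tan_x ≥ d_x ≥ 2` by the certified THEOREM B / 14.3
(every point of `Quot^ι_x(M;1,1)` has local dimension `≥ 2`). So `T₀ ≠ 0 ⟹ e₁^ι ≥ 2` in all cases. [H2-ZERO-ONE-9 §3] -/
theorem qt_torsion_kills (e1 tan₁ tan₂ : ℤ) (hQT : tan₁ + tan₂ ≤ e1) (ht₂ : 0 ≤ tan₂)
    (hcase : 2 ≤ tan₁ ∨ (1 ≤ tan₁ ∧ 1 ≤ tan₂)) : 2 ≤ e1 := by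
  rcases hcase with h | ⟨h₁, h₂⟩ <;> linarith

/-- SANITY INSTANCE (report §2.5, the `n = 1` semisimple quotient of `M_𝔞`): `T₀ = k₊ ⊕ k₋`, `e = (2,8,12,8,2)`, `ext²^ι(M_𝔞,T₀) = 1`, so the bound
reads `tan ≥ 2 − 1 + 6 = 7`; and indeed `tan = μ(F) ≥ 3 + (16 − 12) = 7` (F = three top generators + 𝔪M; `𝔪M/𝔪²M` has dimension `10 + 6 = 16`).
The bound is SHARP there. -/
theorem qt_sanity_n1 : (2 : ℤ) - 8 + 12 - 8 + 2 = 0 ∧ (2 * 1 - 1 + 12 / 2 : ℤ) = 7 ∧ (3 + (16 - 12) : ℤ) = 7 := by norm_num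

/-- TRACE SPLITTING ⟹ `e² ≥ 6` (report §2.6). `End_k(T₀) = k·id ⊕ ker(tr)` as 𝔞-modules (char 0), so
`Ext²_A(T₀,T₀)^ι = H²(𝔞; End_k T₀)_ev = Λ²(k⁴) ⊕ H²(𝔞; ker tr)_ev`: `e² = 6 + dim H²(𝔞; ker tr)_ev ≥ 6`; likewise `e⁰ = 1 + …`, `e⁴ = 1 + …`.
Integer skeleton. [H2-ZERO-ONE-9 §2.6] -/
theorem qt_e2_ge_six (e2 r : ℤ) (hsplit : e2 = 6 + r) (hr : 0 ≤ r) : 6 ≤ e2 := by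
  omega

/-- (T³) `tan ≥ (2 − β₂)·n + 3 ≥ 3` FOR ALL SIX HULLS AND ALL `n ≥ 1` (report §2.7). Inputs: the master inequality
`4n − 2·ext²^ι(M,T₀) + e² ≤ 2·tan` (`qt_master`), `ext²^ι(M,T₀) ≤ β₂·n` (`Hom^ι(P₂,T₀)` has dimension `β₂n`), `β₂ ∈ {0,1,2}` (`qt_betti_hulls`),
`e² ≥ 6` (`qt_e2_ge_six`). With (QT) (`e₁^ι ≥ tan`): `e₁^ι ≥ 3`, so a (0,1) candidate (`e₁^ι = 1`) has NO fixed-point torsion at a point with one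
of these hulls — every `n`, every base ideal, every Loewy length, no class-Z hypothesis. [H2-ZERO-ONE-9 §2.7, §3] -/
theorem qt_tan_ge_three (n tan h2M e2 e1 : ℤ) (hmaster : 4 * n - 2 * h2M + e2 ≤ 2 * tan) (hn : 1 ≤ n) (he2 : 6 ≤ e2)
    (hQT : tan ≤ e1) :
    (h2M ≤ 2 * n → 3 ≤ tan ∧ 3 ≤ e1 ∧ e1 ≠ 1) ∧ (h2M ≤ n → n + 3 ≤ tan ∧ 4 ≤ tan) ∧ (h2M = 0 → 2 * n + 3 ≤ tan) := by
  refine ⟨fun h => ⟨by omega, by omega, by omega⟩, fun h => ⟨by omega, by omega⟩, fun h => by omega⟩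

/-- THE TYPE-'d' CORNER WITHOUT THE TRACE: if the second-syzygy map `d¹ : Hom^ι(P₁,T₀) → Hom^ι(P₂,T₀) = V₊ ⊕ V₋` of the hull 'd' vanishes, its
entries force `X₁ = X₂ = X₄ = 0` and `X₃² = 0` on `T₀`, so `T₀` is a `k[x₃]/(x₃²)`-module and `e² = 6·c_o` with `c_o = dim C(X₃)_odd ≥ 1`
(report §2.8: `Z¹ = C(X₃)_odd³ × End_odd`, `B¹ ≅ 𝔤/C(X₃)_ev`); recorded as a cross-check of `qt_e2_ge_six` in the most degenerate case. -/
theorem qt_typed_rank_zero (n c_o e0 e1 e2 dimZ1 dimB1 : ℤ) (hZ : dimZ1 = 3 * c_o + 2 * n ^ 2) (hB : dimB1 = 2 * n ^ 2 - e0)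
    (he1 : e1 = dimZ1 - dimB1) (he2 : e2 = 2 * (e1 - e0)) (hc : 1 ≤ c_o) : e2 = 6 * c_o ∧ 6 ≤ e2 := by
  subst hZ; subst hB; subst he1
  constructor <;> nlinarith

/-- T²′ — UNBALANCED TORSION (report ADDENDUM 1, A1.2; a tool for the existence side, where the hull `E` or the sheaf `G` may carry index at the
fixed point so that `T₀` has sign-lengths `(n₊,n₋)` with `n₊ ≠ n₋`). The same long exact sequence gives `tan = χ^ι(M,T₀) − h²_M + (e¹ − e⁰) + ρ′` with
`χ^ι(M,T₀) = Σ_j (−1)^j (β_j⁺n₊ + β_j⁻n₋)` (equivariant Betti numbers of the hull), and now `χ^ι(T₀,T₀) = 8(n₊ − n₋)²` (`qt_chi_T0`) with duality gives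
`2(e¹ − e⁰) = e² − 8(n₊ − n₋)²`; with `e² ≥ 6`: **`tan ≥ χ^ι(M,T₀) − h²_M + 3 − 4(n₊ − n₋)²`**. Integer skeleton; machine check `qt_check.py … modes=unbal`. -/
theorem qt_master_unbalanced (np nm tan chiM h0M h1M h2M e0 e1 e2 : ℤ)
    (hles : h0M + e1 ≤ e0 + tan + h1M) (hchiM : h0M - h1M + h2M = chiM)
    (hdual : 2 * e1 = 2 * e0 + e2 - 8 * (np - nm) ^ 2) (he2 : 6 ≤ e2) :
    2 * chiM - 2 * h2M + e2 - 8 * (np - nm) ^ 2 ≤ 2 * tan ∧ chiM - h2M + 3 - 4 * (np - nm) ^ 2 ≤ tan := by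
  constructor <;> nlinarith [sq_nonneg (np - nm)]

/-- The duality/index identity behind `qt_master_unbalanced`: `e³ = e¹`, `e⁴ = e⁰` and `e⁰ − e¹ + e² − e³ + e⁴ = 8(n₊ − n₋)²` give
`2e¹ = 2e⁰ + e² − 8(n₊ − n₋)²`. -/
theorem qt_e1_formula_unbalanced (np nm e0 e1 e2 e3 e4 : ℤ) (hd3 : e3 = e1) (hd4 : e4 = e0)
    (hchi : e0 - e1 + e2 - e3 + e4 = 8 * (np - nm) ^ 2) : 2 * e1 = 2 * e0 + e2 - 8 * (np - nm) ^ 2 := by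
  subst hd3; subst hd4; linarith

/-- EXAMPLE for the existence side (report ADDENDUM 1, A1.3): the VERTEX MODULE of H2-EXISTENCE-SIDE-2 §4.2 has equivariant Betti numbers
`P₀ = (1₊, 7₋)`, `P₁ = (8₊, 0₋)` (eight linear syzygies of sign +, nothing else — certified GP3g9-2 / machine 4.3), hence `β₂ = 8 − 8 + 2 = 2` (rank 2,
`pd ≤ 2`) and `χ^ι(M,T₀) = (n₊ + 7n₋) − 8n₊ + (β₂⁺n₊ + β₂⁻n₋)` with `β₂⁺ + β₂⁻ = 2`; since `h²_M ≤ β₂⁺n₊ + β₂⁻n₋`, T²′ gives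
`tan ≥ 7(n₋ − n₊) + 3 − 4(n₊ − n₋)²` at every point of its ι-Quot scheme: `≥ 3` for balanced torsion and `≥ 6` for `(n₊,n₋) = (n, n+1)` — so (with (QT))
vertex torsion of those sign-lengths cannot occur on a (0,1) object; for `n₊ > n₋` the bound is void and the second-syzygy ranks are needed. -/
theorem qt_vertex_module (np nm tan chiM h2M b2p b2m : ℤ)
    (hchi : chiM = (np + 7 * nm) - 8 * np + (b2p * np + b2m * nm)) (hh2 : h2M ≤ b2p * np + b2m * nm)
    (hT : chiM - h2M + 3 - 4 * (np - nm) ^ 2 ≤ tan) :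
    7 * (nm - np) + 3 - 4 * (np - nm) ^ 2 ≤ tan ∧ (np = nm → 3 ≤ tan) ∧ (nm = np + 1 → 6 ≤ tan) := by
  refine ⟨by nlinarith, fun h => ?_, fun h => ?_⟩
  · subst h; nlinarith
  · subst h; nlinarith

end H2QuotTangent

end Summit.HodgeConjecture.HodgeConjecture.WeilTypeLadder
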